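import Mathlib.Analysis.ODE.ExistUnique
import Mathlib.Analysis.Calculus.ContDiff.RCLike
import Mathlib.Analysis.InnerProductSpace.Calculus
import Mathlib.MeasureTheory.Integral.IntervalIntegral.FundThmCalculus
import Literature.Analysis.FunctionSpaces.PotentialDynamics
import HarnessLib

/-!
# Discharged fact: uniqueness of the `N`-body potential flow in `ℝ^d` on the good set

`Literature.Analysis.FunctionSpaces.PotentialDynamics` records as the named fact
`PotentialFlow.eqOn_of_mem_good_euclidean` that two potential flows
`Ψ₁ Ψ₂ : PotentialFlow (Euclidean.geometry d) Φ ε N` of `N` particles interacting through the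
rescaled short-range potential `Φ_ε` in the whole space agree, at all times, on the intersection
of their good sets (Gallagher–Saint-Raymond–Texier 2013: Newton's equations (1.2.2) for a
potential satisfying Assumption 1.2.1, the `N`-particle Hamiltonian flow on
`Ω_N = {∀ i ≠ j, x_i ≠ x_j}` of Part III Ch. 9; uniqueness of Hamiltonian trajectories is the
Cauchy–Lipschitz theorem, "a consequence of the regularity assumption on the potential", as the
source puts it for the two-body problem in Ch. 8 §2 — arXiv:1208.5753 numbering). It is proved
here (`PotentialFlow.eqOn_of_mem_good_euclidean_holds`):

* `ShortRangePotential.contDiffAt_scaled`, `ShortRangePotential.contDiffAt_gradient_scaled`: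
  the radial profile `φ` is `C²` on `(0, ∞)` and the Euclidean norm is smooth off the origin, so
  `Φ_ε = φ(|ε⁻¹ ·|)` is `C²` and its gradient `C¹` away from the origin (for `ε = 0` the rescaled
  potential is constant);
* `contDiffAt_force_euclidean`, `contDiffAt_hamiltonianField_euclidean`: on the open
  non-coincidence set the force `-∑_{j ≠ i} ∇Φ_ε (x_i - x_j)` and the Hamiltonian vector field
  `(x, v) ↦ (v, F(x))` are `C¹`, hence Lipschitz near each non-coincident configuration
  (`ContDiffAt.exists_lipschitzOnWith`);
* `PotentialFlow.hasDerivAt_flow_euclidean`: the orbit of a good point is an honest solution of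
  the ODE in the normed phase space `Fin N → ℝ^d × ℝ^d` (velocities by `vel_hasDerivAt`,
  positions by the fundamental theorem of calculus applied to `x_i(t) = x_i(0) + ∫₀ᵗ v_i`);
* the set of times where the two orbits of a common good point coincide contains `0`
  (`flow_zero`), is closed (continuity) and open (Mathlib's local uniqueness
  `ODE_solution_unique_of_eventually`, the orbits staying in the good set, which avoids
  coincidences), hence is all of `ℝ`.

No statement of `PotentialDynamics` is changed; this file only adds proofs.

## References

* I. Gallagher, L. Saint-Raymond, B. Texier, *From Newton to Boltzmann: hard spheres and
  short-range potentials*, Zurich Lectures in Advanced Mathematics, EMS (2013); arXiv:1208.5753,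
  Part I Ch. 1 §2 ((1.2.2), Assumption 1.2.1), Part III Ch. 8 §2 (Cauchy–Lipschitz for the
  reduced motion) and Ch. 9 (the `N`-particle Hamiltonian flow on `Ω_N`, §9.5).
-/

open MeasureTheory Metric Set Filter Topology
open scoped NNReal

noncomputable section

namespace Literature.Analysis.FunctionSpaces

variable {d : Type*} [Fintype d] {N : ℕ}

namespace ShortRangePotential

/-- The rescaled potential `Φ_ε = φ(|ε⁻¹ ·|)` is `C²` away from the origin: `φ` is `C²` on
`(0, ∞)` (GST 2013 Assumption 1.2.1) and the Euclidean norm is smooth off `0`; for `ε = 0` the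
rescaled potential is the constant `φ 0`. [folklore] -/
theorem contDiffAt_scaled (Φ : ShortRangePotential d) (ε : ℝ) {y : EuclideanSpace ℝ d}
    (hy : y ≠ 0) : ContDiffAt ℝ 2 (Φ.scaled ε) y := by
  have hs : Φ.scaled ε = fun x => Φ.φ ‖ε⁻¹ • x‖ := rfl
  rw [hs]
  rcases eq_or_ne ε 0 with rfl | hε
  · simp only [inv_zero, zero_smul, norm_zero]
    exact contDiffAt_const
  · have h0 : ε⁻¹ • y ≠ 0 := smul_ne_zero (inv_ne_zero hε) hy
    have h1 : ContDiffAt ℝ 2 (fun x : EuclideanSpace ℝ d => ‖ε⁻¹ • x‖) y :=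
      (contDiff_const_smul ε⁻¹).contDiffAt.norm ℝ h0
    have h2 : ContDiffAt ℝ 2 Φ.φ ‖ε⁻¹ • y‖ :=
      Φ.contDiffOn.contDiffAt (Ioi_mem_nhds (norm_pos_iff.mpr h0))
    exact h2.comp y h1

/-- The gradient of the rescaled potential is `C¹` away from the origin (the gradient is the
Fréchet derivative read through the Riesz isometry, and `Φ_ε` is `C²` there). [folklore] -/
theorem contDiffAt_gradient_scaled (Φ : ShortRangePotential d) (ε : ℝ) {y : EuclideanSpace ℝ d}
    (hy : y ≠ 0) : ContDiffAt ℝ 1 (gradient (Φ.scaled ε)) y := by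
  have hL : IsBoundedLinearMap ℝ fun ℓ : StrongDual ℝ (EuclideanSpace ℝ d) =>
      (InnerProductSpace.toDual ℝ (EuclideanSpace ℝ d)).symm ℓ :=
    { map_add := fun x x' => map_add _ x x'
      map_smul := fun c x => by
        rw [map_smulₛₗ, starRingEnd_apply, star_trivial]
      bound := ⟨1, one_pos, fun x => by
        rw [one_mul, LinearIsometryEquiv.norm_map]⟩ }
  have hf : ContDiffAt ℝ 1 (fderiv ℝ (Φ.scaled ε)) y :=
    (Φ.contDiffAt_scaled ε hy).fderiv_right (le_of_eq one_add_one_eq_two)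
  exact hL.contDiff.contDiffAt.comp y hf

end ShortRangePotential

/-- On the non-coincidence set of the whole-space geometry the force on each particle,
`F_i(z) = -∑_{j ≠ i} ∇Φ_ε (x_i - x_j)`, is a `C¹` function of the configuration (each
separation `x_i - x_j`, `j ≠ i`, stays away from the origin, where `∇Φ_ε` is `C¹`). [folklore] -/
theorem contDiffAt_force_euclidean (Φ : ShortRangePotential d) (ε : ℝ)
    {z : FluidPDE.Config N d (EuclideanSpace ℝ d)}
    (hz : z ∈ noCoincidence (FluidPDE.Euclidean.geometry d) N) (i : Fin N) :
    ContDiffAt ℝ 1 (fun z' : FluidPDE.Config N d (EuclideanSpace ℝ d) =>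
      force (FluidPDE.Euclidean.geometry d) Φ ε z' i) z := by
  have hsum : ContDiffAt ℝ 1 (fun z' : FluidPDE.Config N d (EuclideanSpace ℝ d) =>
      ∑ j ∈ Finset.univ.erase i, gradient (Φ.scaled ε) ((z' i).1 - (z' j).1)) z := by
    refine ContDiffAt.sum fun j hj => ?_
    have hne : (z i).1 - (z j).1 ≠ 0 := hz i j (Finset.ne_of_mem_erase hj).symm
    have hlin : ContDiff ℝ 1
        (fun z' : FluidPDE.Config N d (EuclideanSpace ℝ d) => (z' i).1 - (z' j).1) :=
      ((contDiff_apply ℝ (EuclideanSpace ℝ d × EuclideanSpace ℝ d) i).fst).sub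
        ((contDiff_apply ℝ (EuclideanSpace ℝ d × EuclideanSpace ℝ d) j).fst)
    have hcomp : ContDiffAt ℝ 1 (gradient (Φ.scaled ε) ∘
        fun z' : FluidPDE.Config N d (EuclideanSpace ℝ d) => (z' i).1 - (z' j).1) z :=
      (Φ.contDiffAt_gradient_scaled ε hne).comp z hlin.contDiffAt
    exact hcomp
  exact hsum.neg

/-- On the non-coincidence set the Hamiltonian vector field `(x_i, v_i)_i ↦ (v_i, F_i(z))_i` of
Newton's equations (GST 2013 (1.2.2)) on the phase space `Fin N → ℝ^d × ℝ^d` is `C¹`. [folklore] -/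
theorem contDiffAt_hamiltonianField_euclidean (Φ : ShortRangePotential d) (ε : ℝ)
    {z : FluidPDE.Config N d (EuclideanSpace ℝ d)}
    (hz : z ∈ noCoincidence (FluidPDE.Euclidean.geometry d) N) :
    ContDiffAt ℝ 1 (fun (z' : FluidPDE.Config N d (EuclideanSpace ℝ d)) (i : Fin N) =>
      ((z' i).2, force (FluidPDE.Euclidean.geometry d) Φ ε z' i)) z :=
  contDiffAt_pi.mpr fun i =>
    ((contDiff_apply ℝ (EuclideanSpace ℝ d × EuclideanSpace ℝ d) i).snd.contDiffAt).prodMk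
      (contDiffAt_force_euclidean Φ ε hz i)

namespace PotentialFlow

variable {Φ : ShortRangePotential d} {ε : ℝ}

/-- The orbit of a good point under a whole-space potential flow solves Newton's equations as an
ODE in the normed phase space `Fin N → ℝ^d × ℝ^d`: `d/dt (x_i, v_i) = (v_i, F_i)` (velocities
by `vel_hasDerivAt`; positions by the fundamental theorem of calculus, since
`x_i(t) = x_i(0) + ∫₀ᵗ v_i` with `v_i` continuous). [folklore] -/
theorem hasDerivAt_flow_euclidean (Ψ : PotentialFlow (FluidPDE.Euclidean.geometry d) Φ ε N)
    {z : FluidPDE.Config N d (EuclideanSpace ℝ d)} (hz : z ∈ Ψ.good) (t : ℝ) :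
    HasDerivAt (fun s => Ψ.flow s z)
      (fun i => ((Ψ.flow t z i).2, force (FluidPDE.Euclidean.geometry d) Φ ε (Ψ.flow t z) i))
      t := by
  have hγ := Ψ.isTrajectory z hz
  refine hasDerivAt_pi.mpr fun i => ?_
  have hv : ∀ s, HasDerivAt (fun s => (Ψ.flow s z i).2)
      (force (FluidPDE.Euclidean.geometry d) Φ ε (Ψ.flow s z) i) s :=
    fun s => hγ.vel_hasDerivAt s i
  have hvc : Continuous fun s => (Ψ.flow s z i).2 :=
    continuous_iff_continuousAt.mpr fun s => (hv s).continuousAt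
  have hp : HasDerivAt (fun s => (Ψ.flow s z i).1) ((Ψ.flow t z i).2) t := by
    have heq : (fun s => (Ψ.flow s z i).1) =
        fun s => (Ψ.flow 0 z i).1 + ∫ τ in (0 : ℝ)..s, (Ψ.flow τ z i).2 := by
      funext s
      exact hγ.pos_eq s i
    rw [heq]
    exact (hvc.integral_hasStrictDerivAt 0 t).hasDerivAt.const_add _
  exact hp.prodMk (hv t)

/-- Orbits of good points under a whole-space potential flow are continuous in time. [folklore] -/
theorem continuous_flow_euclidean (Ψ : PotentialFlow (FluidPDE.Euclidean.geometry d) Φ ε N)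
    {z : FluidPDE.Config N d (EuclideanSpace ℝ d)} (hz : z ∈ Ψ.good) :
    Continuous fun s => Ψ.flow s z :=
  continuous_iff_continuousAt.mpr fun s => (Ψ.hasDerivAt_flow_euclidean hz s).continuousAt

/-- **Discharge of `PotentialFlow.eqOn_of_mem_good_euclidean`** (uniqueness of the `N`-body
potential flow in `ℝ^d` on the good set). Two potential flows agree at all times on the
intersection of their good sets: both orbits of a common good point `z` solve Newton's equations
(GST 2013 (1.2.2)) in the phase space `Fin N → ℝ^d × ℝ^d` and stay in the good set, hence in
the non-coincidence set `Ω_N` (GST 2013 Part III Ch. 9), where the vector field is `C¹` — `φ` is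
`C²` off the origin by Assumption 1.2.1 — hence locally Lipschitz; so the set of times where
the orbits coincide contains `0`, is closed, and is open by the Cauchy–Lipschitz theorem (local
uniqueness, Mathlib's `ODE_solution_unique_of_eventually`), i.e. it is all of `ℝ`. The source
invokes exactly this uniqueness "via the Cauchy–Lipschitz theorem, a consequence of the regularity
assumption on the potential" (Ch. 8 §2, for the reduced two-body motion). [cite: GallagherSaintRaymondTexier2013, Part I Ch. 1 §2 (1.2.2) & Assumption 1.2.1; Part III Ch. 9 (Hamiltonian flow on Ω_N, §9.5) and Ch. 8 §2 (Cauchy–Lipschitz uniqueness); arXiv:1208.5753 numbering] -/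
theorem eqOn_of_mem_good_euclidean_holds :
    eqOn_of_mem_good_euclidean (d := d) (N := N) (Φ := Φ) (ε := ε) := by
  intro Ψ₁ Ψ₂ z hz t
  obtain ⟨hz₁, hz₂⟩ := hz
  have h₁ := fun s => Ψ₁.hasDerivAt_flow_euclidean hz₁ s
  have h₂ := fun s => Ψ₂.hasDerivAt_flow_euclidean hz₂ s
  have hc₁ := Ψ₁.continuous_flow_euclidean hz₁
  have hc₂ := Ψ₂.continuous_flow_euclidean hz₂
  -- the set of times where the two orbits coincide is clopen and contains `0`
  have hclosed : IsClosed {s : ℝ | Ψ₁.flow s z = Ψ₂.flow s z} := isClosed_eq hc₁ hc₂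
  have hopen : IsOpen {s : ℝ | Ψ₁.flow s z = Ψ₂.flow s z} := by
    rw [isOpen_iff_mem_nhds]
    intro t₀ ht₀
    have ht₀' : Ψ₁.flow t₀ z = Ψ₂.flow t₀ z := ht₀
    have hgood : Ψ₁.flow t₀ z ∈ noCoincidence (FluidPDE.Euclidean.geometry d) N :=
      Ψ₁.good_subset (Ψ₁.mapsTo_good t₀ hz₁)
    obtain ⟨K, U, hU, hK⟩ :=
      (contDiffAt_hamiltonianField_euclidean Φ ε hgood).exists_lipschitzOnWith
    have hev₁ : ∀ᶠ s in 𝓝 t₀, HasDerivAt (fun s => Ψ₁.flow s z)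
        (fun i => ((Ψ₁.flow s z i).2,
          force (FluidPDE.Euclidean.geometry d) Φ ε (Ψ₁.flow s z) i)) s ∧ Ψ₁.flow s z ∈ U :=
      (hc₁.continuousAt.eventually_mem hU).mono fun s hs => ⟨h₁ s, hs⟩
    have hU₂ : U ∈ 𝓝 (Ψ₂.flow t₀ z) := ht₀' ▸ hU
    have hev₂ : ∀ᶠ s in 𝓝 t₀, HasDerivAt (fun s => Ψ₂.flow s z)
        (fun i => ((Ψ₂.flow s z i).2,
          force (FluidPDE.Euclidean.geometry d) Φ ε (Ψ₂.flow s z) i)) s ∧ Ψ₂.flow s z ∈ U :=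
      (hc₂.continuousAt.eventually_mem hU₂).mono fun s hs => ⟨h₂ s, hs⟩
    have key : ∀ᶠ s in 𝓝 t₀, Ψ₁.flow s z = Ψ₂.flow s z :=
      ODE_solution_unique_of_eventually
        (v := fun _ (z' : FluidPDE.Config N d (EuclideanSpace ℝ d)) (i : Fin N) =>
          ((z' i).2, force (FluidPDE.Euclidean.geometry d) Φ ε z' i))
        (s := fun _ => U) (Eventually.of_forall fun _ => hK) hev₁ hev₂ ht₀'
    exact key
  have huniv : {s : ℝ | Ψ₁.flow s z = Ψ₂.flow s z} = univ :=
    IsClopen.eq_univ ⟨hclosed, hopen⟩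
      ⟨0, show Ψ₁.flow 0 z = Ψ₂.flow 0 z by rw [Ψ₁.flow_zero z hz₁, Ψ₂.flow_zero z hz₂]⟩
  have ht : t ∈ {s : ℝ | Ψ₁.flow s z = Ψ₂.flow s z} := huniv ▸ mem_univ t
  exact ht

end PotentialFlow

end Literature.Analysis.FunctionSpaces
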